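import Summits.QuantumAdvantage.QuantumAdvantage.Theorems.CertDialF
import HarnessLib

/-!
# CertDial (G) — decomp-qadv lens-2 (structural dichotomy: special vs generic), generation 28, part 7/7

Part 7 of NODE «CertDial» (memo in part A's header and `NODE-g28.md`): §9 ★★★ FIVE LIGHTS — THE CONTRAST THEOREM of the dial.  Against
LOW-DEGREE strategies no bounded family of light inputs is universal (part C, Thm B′ `no_bounded_universal_family`) and no XOR certificate exists
(part A, Thm A); against `r`-LOCAL answer maps (`IsWindowLocal r z`: output `b` reads only the radius-`r` window `LightConeWindowHard.window r x b`
— arbitrary position-dependent tables, no covariance, NO degree bound) FIVE explicit odd-class inputs of weight `≤ 3` already form a universal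
family, BY a XOR certificate.  With `B, C, D, K = 2r+2, 4r+3, 6r+4, 8r+5` the lights are `light₁ = 1_{0,B,K}`, `light₂ = 1_{0,D,K}`,
`light₃ = 1_{B,C,D}`, `lightPt (4r+3)`, `lightPt (6r+4)`; by the part-F atlas (`rel_tri_iff`, `rel_triAt_iff`, `rel_single_iff`) their laws read
`#{b ∈ K_m : z b = 1} ≡ c_m (mod 2)` with electorates `K = E∪[0,B)`, `E∪[0,D)`, `E∪[0,B)∪[D,n)`, `E`, `O` (`E/O` = even/odd positions) and targets
`c = 1, 1, 1, 0, 0`.  Every row `b` lies in an even number of the `K_m`, and the lights whose electorate contains `b` PAIR UP WITH EQUAL WINDOWS at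
`b` (`z_light₁₂`, `z_light₁₃`, `z_light₂₃`, `z_light₃₄`, `z_light₂₅`, `z_light₃₅`, `z_light₁₄`, `z_light₂₄`; the pairing depends on which of
`0, B, C, D, K` the window of `b` can see), so for a LOCAL map the five counts have even sum — against the odd target sum:
`five_lights` (even `n ≥ 12r+8`: no `r`-local answer map wins all five), `localLightLaw_three` / `localLightFail_three` (every `r`-local answer map /
window-local strategy `P : Fin n → CubeFn (ZMod 3) n`, ANY degree, loses an odd-class input of weight `≤ 3`), and `five_lights_affine_winner`
(`n ≥ 176`: some AFFINE strategy wins all five, hence its answer map is not `r`-local) — the five lights SEPARATE «local» from «affine».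
For the lineage: the generic leaf `PGlobalFail 2 2 7` splits into a LOCAL sub-leaf (discharged here at weight 3, uniformly in the degree) and a
LONG-RANGE low-degree remainder (immune to certificate levels 0–2 by parts A/C/E).  Nothing here proves or refutes the generic leaves or 27432.
`lean check` on the tree closure: rc 0, no warnings, no placeholders; axioms standard (`propext`, `Classical.choice`, `Quot.sound`).
-/

set_option linter.dupNamespace false
set_option linter.style.longLine false

noncomputable section
open scoped Classical

namespace Summit.QuantumAdvantage.QuantumAdvantage.Theorems.CertDial
open Finset
open Literature.Computability.QuantumComplexity Literature.Computability.QuantumComplexity.RingHLF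
open Summit.QuantumAdvantage.AdviceFreeQNC0
open Literature.Computability.MetaComplexity Literature.Computability.MetaComplexity.Smolensky
open Summit.QuantumAdvantage.QuantumAdvantage.Theorems.LightDial (wt)
open Summit.QuantumAdvantage.QuantumAdvantage.Theorems.ParityDial (par offs)
open Summit.QuantumAdvantage.AdviceFreeQNC0.LightConeWindowHard (window)
open Summit.QuantumAdvantage.AdviceFreeQNC0.RingSymmetry (shift card_filter_shift)

variable {n : ℕ}

/-! ## §9 FIVE LIGHTS — a size-5, weight-≤3 universal family against every LIGHT CONE (r-local strategies, any tables)

The contrast theorem of the dial.  Against LOW-DEGREE strategies no bounded family of light inputs is universal (Thm B′) and no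
XOR certificate exists (Thm A); against `r`-LOCAL strategies (output `b` reads only the radius-`r` window — arbitrary,
position-dependent tables, no covariance, no degree bound) FIVE explicit inputs of weight `≤ 3` already form a universal family,
BY an XOR certificate: with `B = 2r+2, C = 4r+3, D = 6r+4, K = 8r+5` the inputs `{0,B,K}`, `{0,D,K}`, `{B,C,D}`, `{C}`, `{D}`
have electorates (§8) `E ∪ [0,B)`, `E ∪ [0,D)`, `E ∪ [0,B] ∪ [D,n)`, `E`, `O` and targets odd, odd, odd, even, even; every row
`b` lies in an even number of these electorates WITH EQUAL WINDOWS pairwise, so for a local strategy the five counts have even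
sum — against the odd target sum.  Hence every `r`-local strategy loses one of the five (even `n ≥ 12r + 8`). -/

open Summit.QuantumAdvantage.AdviceFreeQNC0.LightConeWindowHard (window_apply)

/-- `r`-LOCAL answer maps: output `b` depends only on the radius-`r` window of the input at `b` (tables may depend on `b`). -/
def IsWindowLocal (r : ℕ) (z : (Fin n → Bool) → Fin n → Bool) : Prop :=
  ∀ x x' : Fin n → Bool, ∀ b : Fin n, window r x b = window r x' b → z x b = z x' b

/-- light 1: ones at `0, 2r+2, 8r+5`. -/
def light₁ (n r : ℕ) : Fin n → Bool := tri n (2 * r + 2) (8 * r + 5)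

/-- light 2: ones at `0, 6r+4, 8r+5`. -/
def light₂ (n r : ℕ) : Fin n → Bool := tri n (6 * r + 4) (8 * r + 5)

/-- light 3: ones at `2r+2, 4r+3, 6r+4` (the odd one BETWEEN the even pair). -/
def light₃ (n r : ℕ) : Fin n → Bool := fun b => decide ((b : ℕ) = 2 * r + 2 ∨ (b : ℕ) = 4 * r + 3 ∨ (b : ℕ) = 6 * r + 4)

/-- light 4 / light 5: the singletons at `4r+3` and `6r+4`. -/
def lightPt (n c : ℕ) : Fin n → Bool := fun b => decide ((b : ℕ) = c)

/-- `lightPt n c` is `single ⟨c, _⟩`. -/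
theorem lightPt_eq_single {c : ℕ} (hc : c < n) : lightPt n c = single (⟨c, hc⟩ : Fin n) := by
  funext b; simp [lightPt, single, Fin.ext_iff]

/-- `light₃` is the general-position two-one input at `i = 6r+4` with offsets `d = n − 4r − 2`, `e = n − 2r − 1`. -/
theorem light₃_eq_triAt (r : ℕ) (hn : 8 * r + 6 ≤ n) :
    light₃ n r = triAt (⟨6 * r + 4, by omega⟩ : Fin n) (n - 4 * r - 2) (n - 2 * r - 1) := by
  funext b; have hb := b.isLt
  simp only [light₃, triAt, offs, decide_eq_decide]
  split_ifs <;> omega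

/-- the law of light 3: `Rel ⟺ #{b : (b even ∨ b < 2r+2 ∨ 6r+4 ≤ b), z b = 1}` odd. -/
theorem rel_light₃_iff (r : ℕ) (he : n % 2 = 0) (hn : 8 * r + 6 ≤ n) (z : Fin n → Bool) :
    Rel (light₃ n r) z ↔
      (univ.filter fun b : Fin n => ((b : ℕ) % 2 = 0 ∨ (b : ℕ) < 2 * r + 2 ∨ 6 * r + 4 ≤ (b : ℕ)) ∧ z b = true).card % 2 = 1 := by
  rw [light₃_eq_triAt r hn, rel_triAt_iff he (by omega) _ (by omega) (by omega) (by omega) (by omega) (by omega) z]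
  rw [Finset.filter_congr fun (b : Fin n) _ => show
      ((offs b (⟨6 * r + 4, by omega⟩ : Fin n) % 2 = 0 ∨ offs b (⟨6 * r + 4, by omega⟩ : Fin n) < n - 4 * r - 2) ∧ z b = true) ↔
      (((b : ℕ) % 2 = 0 ∨ (b : ℕ) < 2 * r + 2 ∨ 6 * r + 4 ≤ (b : ℕ)) ∧ z b = true) by
    have hb := b.isLt
    simp only [offs]
    constructor
    · rintro ⟨h, hz⟩; refine ⟨?_, hz⟩; split_ifs at h <;> omega
    · rintro ⟨h, hz⟩; refine ⟨?_, hz⟩; split_ifs <;> omega]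

/-- the law of a singleton at an odd position `c`: `Rel ⟺ #{b even : z b = 1}` even. -/
theorem rel_pt_odd_iff (he : n % 2 = 0) (hn : 3 ≤ n) {c : ℕ} (hc : c < n) (hc1 : c % 2 = 1) (z : Fin n → Bool) :
    Rel (lightPt n c) z ↔ (univ.filter fun b : Fin n => (b : ℕ) % 2 = 0 ∧ z b = true).card % 2 = 0 := by
  rw [lightPt_eq_single hc, rel_single_iff he hn _ z]
  rw [Finset.filter_congr fun (b : Fin n) _ => show (par b ≠ par (⟨c, hc⟩ : Fin n) ∧ z b = true) ↔ ((b : ℕ) % 2 = 0 ∧ z b = true) by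
    simp only [par, ne_eq, decide_eq_decide]; constructor <;> rintro ⟨h, hz⟩ <;> exact ⟨by omega, hz⟩]

/-- the law of a singleton at an even position `c`: `Rel ⟺ #{b odd : z b = 1}` even. -/
theorem rel_pt_even_iff (he : n % 2 = 0) (hn : 3 ≤ n) {c : ℕ} (hc : c < n) (hc0 : c % 2 = 0) (z : Fin n → Bool) :
    Rel (lightPt n c) z ↔ (univ.filter fun b : Fin n => (b : ℕ) % 2 = 1 ∧ z b = true).card % 2 = 0 := by
  rw [lightPt_eq_single hc, rel_single_iff he hn _ z]
  rw [Finset.filter_congr fun (b : Fin n) _ => show (par b ≠ par (⟨c, hc⟩ : Fin n) ∧ z b = true) ↔ ((b : ℕ) % 2 = 1 ∧ z b = true) by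
    simp only [par, ne_eq, decide_eq_decide]; constructor <;> rintro ⟨h, hz⟩ <;> exact ⟨by omega, hz⟩]

section Windows
variable {r : ℕ} {z : (Fin n → Bool) → Fin n → Bool}

/-- lightFamily 1 and 2 differ only at `2r+2` and `6r+4`: a local strategy answers them alike at every row far from both. -/
theorem z_light₁₂ (hz : IsWindowLocal r z) (hn : 12 * r + 8 ≤ n) (b : Fin n)
    (hB : 3 * r + 2 < (b : ℕ) ∨ (b : ℕ) + r < 2 * r + 2) (hD : 7 * r + 4 < (b : ℕ) ∨ (b : ℕ) + r < 6 * r + 4) :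
    z (light₁ n r) b = z (light₂ n r) b := by
  apply hz; funext d; have hd := d.isLt; have hb := b.isLt
  rw [window_apply r (by omega), window_apply r (by omega)]
  simp only [light₁, light₂, tri, decide_eq_decide]
  split_ifs <;> omega

/-- lightFamily 1 and 3 differ at `0, 8r+5, 4r+3, 6r+4`. -/
theorem z_light₁₃ (hz : IsWindowLocal r z) (hn : 12 * r + 8 ≤ n) (b : Fin n)
    (hA : r < (b : ℕ) ∧ (b : ℕ) + r < n) (hK : 9 * r + 5 < (b : ℕ) ∨ (b : ℕ) + r < 8 * r + 5)
    (hC : 5 * r + 3 < (b : ℕ) ∨ (b : ℕ) + r < 4 * r + 3) (hD : 7 * r + 4 < (b : ℕ) ∨ (b : ℕ) + r < 6 * r + 4) :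
    z (light₁ n r) b = z (light₃ n r) b := by
  apply hz; funext d; have hd := d.isLt; have hb := b.isLt
  rw [window_apply r (by omega), window_apply r (by omega)]
  simp only [light₁, light₃, tri, decide_eq_decide]
  split_ifs <;> omega

/-- lightFamily 2 and 3 differ at `0, 8r+5, 2r+2, 4r+3`. -/
theorem z_light₂₃ (hz : IsWindowLocal r z) (hn : 12 * r + 8 ≤ n) (b : Fin n)
    (hA : r < (b : ℕ) ∧ (b : ℕ) + r < n) (hK : 9 * r + 5 < (b : ℕ) ∨ (b : ℕ) + r < 8 * r + 5)
    (hB : 3 * r + 2 < (b : ℕ) ∨ (b : ℕ) + r < 2 * r + 2) (hC : 5 * r + 3 < (b : ℕ) ∨ (b : ℕ) + r < 4 * r + 3) :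
    z (light₂ n r) b = z (light₃ n r) b := by
  apply hz; funext d; have hd := d.isLt; have hb := b.isLt
  rw [window_apply r (by omega), window_apply r (by omega)]
  simp only [light₂, light₃, tri, decide_eq_decide]
  split_ifs <;> omega

/-- light 3 and the singleton `4r+3` differ at `2r+2, 6r+4`. -/
theorem z_light₃₄ (hz : IsWindowLocal r z) (hn : 12 * r + 8 ≤ n) (b : Fin n)
    (hB : 3 * r + 2 < (b : ℕ) ∨ (b : ℕ) + r < 2 * r + 2) (hD : 7 * r + 4 < (b : ℕ) ∨ (b : ℕ) + r < 6 * r + 4) :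
    z (light₃ n r) b = z (lightPt n (4 * r + 3)) b := by
  apply hz; funext d; have hd := d.isLt; have hb := b.isLt
  rw [window_apply r (by omega), window_apply r (by omega)]
  simp only [light₃, lightPt, decide_eq_decide]
  split_ifs <;> omega

/-- light 2 and the singleton `6r+4` differ at `0, 8r+5`. -/
theorem z_light₂₅ (hz : IsWindowLocal r z) (hn : 12 * r + 8 ≤ n) (b : Fin n)
    (hA : r < (b : ℕ) ∧ (b : ℕ) + r < n) (hK : 9 * r + 5 < (b : ℕ) ∨ (b : ℕ) + r < 8 * r + 5) :
    z (light₂ n r) b = z (lightPt n (6 * r + 4)) b := by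
  apply hz; funext d; have hd := d.isLt; have hb := b.isLt
  rw [window_apply r (by omega), window_apply r (by omega)]
  simp only [light₂, tri, lightPt, decide_eq_decide]
  split_ifs <;> omega

/-- light 3 and the singleton `6r+4` differ at `2r+2, 4r+3`. -/
theorem z_light₃₅ (hz : IsWindowLocal r z) (hn : 12 * r + 8 ≤ n) (b : Fin n)
    (hB : 3 * r + 2 < (b : ℕ) ∨ (b : ℕ) + r < 2 * r + 2) (hC : 5 * r + 3 < (b : ℕ) ∨ (b : ℕ) + r < 4 * r + 3) :
    z (light₃ n r) b = z (lightPt n (6 * r + 4)) b := by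
  apply hz; funext d; have hd := d.isLt; have hb := b.isLt
  rw [window_apply r (by omega), window_apply r (by omega)]
  simp only [light₃, lightPt, decide_eq_decide]
  split_ifs <;> omega

/-- light 1 and the singleton `4r+3` differ at `0, 2r+2, 8r+5, 4r+3`. -/
theorem z_light₁₄ (hz : IsWindowLocal r z) (hn : 12 * r + 8 ≤ n) (b : Fin n)
    (hA : r < (b : ℕ) ∧ (b : ℕ) + r < n) (hB : 3 * r + 2 < (b : ℕ) ∨ (b : ℕ) + r < 2 * r + 2)
    (hK : 9 * r + 5 < (b : ℕ) ∨ (b : ℕ) + r < 8 * r + 5) (hC : 5 * r + 3 < (b : ℕ) ∨ (b : ℕ) + r < 4 * r + 3) :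
    z (light₁ n r) b = z (lightPt n (4 * r + 3)) b := by
  apply hz; funext d; have hd := d.isLt; have hb := b.isLt
  rw [window_apply r (by omega), window_apply r (by omega)]
  simp only [light₁, tri, lightPt, decide_eq_decide]
  split_ifs <;> omega

/-- light 2 and the singleton `4r+3` differ at `0, 6r+4, 8r+5, 4r+3`. -/
theorem z_light₂₄ (hz : IsWindowLocal r z) (hn : 12 * r + 8 ≤ n) (b : Fin n)
    (hA : r < (b : ℕ) ∧ (b : ℕ) + r < n) (hD : 7 * r + 4 < (b : ℕ) ∨ (b : ℕ) + r < 6 * r + 4)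
    (hK : 9 * r + 5 < (b : ℕ) ∨ (b : ℕ) + r < 8 * r + 5) (hC : 5 * r + 3 < (b : ℕ) ∨ (b : ℕ) + r < 4 * r + 3) :
    z (light₂ n r) b = z (lightPt n (4 * r + 3)) b := by
  apply hz; funext d; have hd := d.isLt; have hb := b.isLt
  rw [window_apply r (by omega), window_apply r (by omega)]
  simp only [light₂, tri, lightPt, decide_eq_decide]
  split_ifs <;> omega

end Windows

/-- bookkeeping: four indicator bits paired two-and-two have an even sum. -/
theorem even_four_of_pairs (a b c d : Bool) (h : (a = b ∧ c = d) ∨ (a = c ∧ b = d) ∨ (a = d ∧ b = c)) :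
    Even ((if a = true then 1 else 0) + (if b = true then 1 else 0) + (if c = true then 1 else 0) + (if d = true then 1 else 0) : ℕ) := by
  revert h a b c d; decide

/-- bookkeeping: two equal indicator bits have an even sum. -/
theorem even_two_of_eq (a b : Bool) (h : a = b) : Even ((if a = true then 1 else 0) + (if b = true then 1 else 0) : ℕ) := by
  revert h a b; decide

/-- ★★★ FIVE LIGHTS.  For even `n ≥ 12r + 8`, every `r`-local answer map loses one of the five inputs `{0, 2r+2, 8r+5}`, `{0, 6r+4, 8r+5}`,
`{2r+2, 4r+3, 6r+4}`, `{4r+3}`, `{6r+4}` (all of weight `≤ 3`, all in the odd class). -/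
theorem five_lights (r : ℕ) (he : n % 2 = 0) (hn : 12 * r + 8 ≤ n) (z : (Fin n → Bool) → Fin n → Bool) (hz : IsWindowLocal r z) :
    ¬ (Rel (light₁ n r) (z (light₁ n r)) ∧ Rel (light₂ n r) (z (light₂ n r)) ∧ Rel (light₃ n r) (z (light₃ n r)) ∧
       Rel (lightPt n (4 * r + 3)) (z (lightPt n (4 * r + 3))) ∧ Rel (lightPt n (6 * r + 4)) (z (lightPt n (6 * r + 4)))) := by
  rintro ⟨H1, H2, H3, H4, H5⟩
  have h1 := (rel_tri_iff he (by omega) (by omega) (by omega) (by omega) (by omega) (by omega) (z (light₁ n r))).1 H1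
  have h2 := (rel_tri_iff he (by omega) (by omega) (by omega) (by omega) (by omega) (by omega) (z (light₂ n r))).1 H2
  have h3 := (rel_light₃_iff r he (by omega) (z (light₃ n r))).1 H3
  have h4 := (rel_pt_odd_iff he (by omega) (by omega) (by omega) (z (lightPt n (4 * r + 3)))).1 H4
  have h5 := (rel_pt_even_iff he (by omega) (by omega) (by omega) (z (lightPt n (6 * r + 4)))).1 H5
  -- the per-row membership count
  set N : Fin n → ℕ := fun b =>
    (if (((b : ℕ) % 2 = 0 ∨ (b : ℕ) < 2 * r + 2) ∧ z (light₁ n r) b = true) then 1 else 0) +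
    (if (((b : ℕ) % 2 = 0 ∨ (b : ℕ) < 6 * r + 4) ∧ z (light₂ n r) b = true) then 1 else 0) +
    (if (((b : ℕ) % 2 = 0 ∨ (b : ℕ) < 2 * r + 2 ∨ 6 * r + 4 ≤ (b : ℕ)) ∧ z (light₃ n r) b = true) then 1 else 0) +
    (if ((b : ℕ) % 2 = 0 ∧ z (lightPt n (4 * r + 3)) b = true) then 1 else 0) +
    (if ((b : ℕ) % 2 = 1 ∧ z (lightPt n (6 * r + 4)) b = true) then 1 else 0) with hN
  have hsum : (univ.filter fun b : Fin n => ((b : ℕ) % 2 = 0 ∨ (b : ℕ) < 2 * r + 2) ∧ z (light₁ n r) b = true).card +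
      (univ.filter fun b : Fin n => ((b : ℕ) % 2 = 0 ∨ (b : ℕ) < 6 * r + 4) ∧ z (light₂ n r) b = true).card +
      (univ.filter fun b : Fin n => ((b : ℕ) % 2 = 0 ∨ (b : ℕ) < 2 * r + 2 ∨ 6 * r + 4 ≤ (b : ℕ)) ∧ z (light₃ n r) b = true).card +
      (univ.filter fun b : Fin n => (b : ℕ) % 2 = 0 ∧ z (lightPt n (4 * r + 3)) b = true).card +
      (univ.filter fun b : Fin n => (b : ℕ) % 2 = 1 ∧ z (lightPt n (6 * r + 4)) b = true).card = ∑ b : Fin n, N b := by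
    simp only [hN, Finset.card_filter, Finset.sum_add_distrib]
  -- … is even, row by row, by locality: the bits of the electorates containing `b` pair up with equal windows
  have heven : ∀ b : Fin n, Even (N b) := by
    intro b
    have hb := b.isLt
    simp only [hN, ite_and]
    rcases Nat.even_or_odd (b : ℕ) with hpe | hpo
    · -- even row: in the electorates of lightFamily 1–4, never of 5; the four bits pair up according to the region of `b`
      have e0 : (b : ℕ) % 2 = 0 := Nat.even_iff.1 hpe
      rw [if_pos (show (b : ℕ) % 2 = 0 ∨ (b : ℕ) < 2 * r + 2 from Or.inl e0),
        if_pos (show (b : ℕ) % 2 = 0 ∨ (b : ℕ) < 6 * r + 4 from Or.inl e0),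
        if_pos (show (b : ℕ) % 2 = 0 ∨ (b : ℕ) < 2 * r + 2 ∨ 6 * r + 4 ≤ (b : ℕ) from Or.inl e0), if_pos e0,
        if_neg (show ¬ (b : ℕ) % 2 = 1 by omega), add_zero]
      apply even_four_of_pairs
      by_cases hnearB : 2 * r + 2 ≤ (b : ℕ) + r ∧ (b : ℕ) ≤ 3 * r + 2
      · exact Or.inr (Or.inl ⟨z_light₁₃ hz hn b ⟨by omega, by omega⟩ (by omega) (by omega) (by omega),
          z_light₂₄ hz hn b ⟨by omega, by omega⟩ (by omega) (by omega) (by omega)⟩)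
      by_cases hnearD : 6 * r + 4 ≤ (b : ℕ) + r ∧ (b : ℕ) ≤ 7 * r + 4
      · exact Or.inr (Or.inr ⟨z_light₁₄ hz hn b ⟨by omega, by omega⟩ (by omega) (by omega) (by omega),
          z_light₂₃ hz hn b ⟨by omega, by omega⟩ (by omega) (by omega) (by omega)⟩)
      · exact Or.inl ⟨z_light₁₂ hz hn b (by omega) (by omega), z_light₃₄ hz hn b (by omega) (by omega)⟩
    · -- odd row: never in electorate 4, always in 5
      have e1 : (b : ℕ) % 2 = 1 := Nat.odd_iff.1 hpo
      have e0 : ¬ (b : ℕ) % 2 = 0 := by omega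
      rw [if_neg e0, if_pos e1, add_zero]
      by_cases hlow : (b : ℕ) < 2 * r + 2
      · rw [if_pos (show (b : ℕ) % 2 = 0 ∨ (b : ℕ) < 2 * r + 2 from Or.inr hlow),
          if_pos (show (b : ℕ) % 2 = 0 ∨ (b : ℕ) < 6 * r + 4 from Or.inr (by omega)),
          if_pos (show (b : ℕ) % 2 = 0 ∨ (b : ℕ) < 2 * r + 2 ∨ 6 * r + 4 ≤ (b : ℕ) from Or.inr (Or.inl hlow))]
        apply even_four_of_pairs
        by_cases hnearB : 2 * r + 2 ≤ (b : ℕ) + r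
        · exact Or.inr (Or.inl ⟨z_light₁₃ hz hn b ⟨by omega, by omega⟩ (by omega) (by omega) (by omega),
            z_light₂₅ hz hn b ⟨by omega, by omega⟩ (by omega)⟩)
        · exact Or.inl ⟨z_light₁₂ hz hn b (by omega) (by omega), z_light₃₅ hz hn b (by omega) (by omega)⟩
      by_cases hmid : (b : ℕ) < 6 * r + 4
      · rw [if_neg (show ¬ ((b : ℕ) % 2 = 0 ∨ (b : ℕ) < 2 * r + 2) by omega),
          if_pos (show (b : ℕ) % 2 = 0 ∨ (b : ℕ) < 6 * r + 4 from Or.inr hmid),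
          if_neg (show ¬ ((b : ℕ) % 2 = 0 ∨ (b : ℕ) < 2 * r + 2 ∨ 6 * r + 4 ≤ (b : ℕ)) by omega), zero_add, add_zero]
        exact even_two_of_eq _ _ (z_light₂₅ hz hn b ⟨by omega, by omega⟩ (by omega))
      · rw [if_neg (show ¬ ((b : ℕ) % 2 = 0 ∨ (b : ℕ) < 2 * r + 2) by omega),
          if_neg (show ¬ ((b : ℕ) % 2 = 0 ∨ (b : ℕ) < 6 * r + 4) by omega),
          if_pos (show (b : ℕ) % 2 = 0 ∨ (b : ℕ) < 2 * r + 2 ∨ 6 * r + 4 ≤ (b : ℕ) from Or.inr (Or.inr (by omega))), zero_add, zero_add]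
        exact even_two_of_eq _ _ (z_light₃₅ hz hn b (by omega) (by omega))
  have htot : Even (∑ b : Fin n, N b) := Finset.even_sum _ fun b _ => heven b
  rw [← hsum, Nat.even_iff] at htot
  omega

/-- weights and classes of the five lightFamily (for the corollary). -/
theorem five_lights_light (r : ℕ) (he : n % 2 = 0) (hn : 12 * r + 8 ≤ n) :
    (OddZeros (light₁ n r) ∧ LightDial.wt (light₁ n r) ≤ 3) ∧ (OddZeros (light₂ n r) ∧ LightDial.wt (light₂ n r) ≤ 3) ∧
    (OddZeros (light₃ n r) ∧ LightDial.wt (light₃ n r) ≤ 3) ∧ (OddZeros (lightPt n (4 * r + 3)) ∧ LightDial.wt (lightPt n (4 * r + 3)) ≤ 3) ∧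
    (OddZeros (lightPt n (6 * r + 4)) ∧ LightDial.wt (lightPt n (6 * r + 4)) ≤ 3) := by
  have hw3 : ∀ (a₁ a₂ a₃ : ℕ), LightDial.wt (fun b : Fin n => decide ((b : ℕ) = a₁ ∨ (b : ℕ) = a₂ ∨ (b : ℕ) = a₃)) ≤ 3 := by
    intro a₁ a₂ a₃
    unfold LightDial.wt
    calc (univ.filter fun b : Fin n => decide ((b : ℕ) = a₁ ∨ (b : ℕ) = a₂ ∨ (b : ℕ) = a₃) = true).card
        ≤ ((univ.filter fun b : Fin n => (b : ℕ) = a₁) ∪ (univ.filter fun b : Fin n => (b : ℕ) = a₂) ∪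
            (univ.filter fun b : Fin n => (b : ℕ) = a₃)).card := by
          apply Finset.card_le_card; intro b; simp only [mem_filter, mem_univ, true_and, mem_union, decide_eq_true_eq]; tauto
      _ ≤ 3 := by
          have h1 : ∀ a : ℕ, (univ.filter fun b : Fin n => (b : ℕ) = a).card ≤ 1 := fun a =>
            Finset.card_le_one.2 fun b hb c hc => by
              simp only [mem_filter, mem_univ, true_and] at hb hc; exact Fin.ext (by omega)
          calc _ ≤ ((univ.filter fun b : Fin n => (b : ℕ) = a₁) ∪ (univ.filter fun b : Fin n => (b : ℕ) = a₂)).card +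
                (univ.filter fun b : Fin n => (b : ℕ) = a₃).card := Finset.card_union_le _ _
            _ ≤ ((univ.filter fun b : Fin n => (b : ℕ) = a₁).card + (univ.filter fun b : Fin n => (b : ℕ) = a₂).card) +
                (univ.filter fun b : Fin n => (b : ℕ) = a₃).card := by gcongr; exact Finset.card_union_le _ _
            _ ≤ (1 + 1) + 1 := by gcongr <;> exact h1 _
  have hw1 : ∀ c : ℕ, LightDial.wt (lightPt n c) ≤ 3 := by
    intro c; unfold LightDial.wt lightPt
    calc (univ.filter fun b : Fin n => decide ((b : ℕ) = c) = true).card ≤ 1 :=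
          Finset.card_le_one.2 fun b hb d hd => by
            simp only [mem_filter, mem_univ, true_and, decide_eq_true_eq] at hb hd; exact Fin.ext (by omega)
      _ ≤ 3 := by omega
  refine ⟨⟨oddZeros_tri he (by omega) (by omega) (by omega), hw3 _ _ _⟩, ⟨oddZeros_tri he (by omega) (by omega) (by omega), hw3 _ _ _⟩,
    ⟨?_, hw3 _ _ _⟩, ⟨?_, hw1 _⟩, ⟨?_, hw1 _⟩⟩
  · rw [light₃_eq_triAt r (by omega), triAt_eq_rot]
    unfold OddZeros
    rw [show (univ.filter fun b : Fin n => rot (n - ((⟨6 * r + 4, by omega⟩ : Fin n) : ℕ)) (tri n (n - 4 * r - 2) (n - 2 * r - 1)) b = false) =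
        univ.filter fun b : Fin n => tri n (n - 4 * r - 2) (n - 2 * r - 1) (shift n (n - ((⟨6 * r + 4, by omega⟩ : Fin n) : ℕ)) b) = false
        from rfl, card_filter_shift _ (fun b : Fin n => tri n (n - 4 * r - 2) (n - 2 * r - 1) b = false)]
    exact oddZeros_tri he (by omega) (by omega) (by omega)
  · rw [lightPt_eq_single (show 4 * r + 3 < n by omega)]; exact oddZeros_single he _
  · rw [lightPt_eq_single (show 6 * r + 4 < n by omega)]; exact oddZeros_single he _

/-- ★★★ THE LOCAL LIGHT LAW at weight 3: for even `n ≥ 12r + 8`, every `r`-local answer map loses an odd-class input of weight `≤ 3`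
(one of the five lightFamily).  Contrast: against degree-`≥ 1` strategies no bounded family of inputs is universal (`no_bounded_universal_family`). -/
theorem localLightLaw_three (r : ℕ) (he : n % 2 = 0) (hn : 12 * r + 8 ≤ n) (z : (Fin n → Bool) → Fin n → Bool)
    (hz : IsWindowLocal r z) : ∃ x : Fin n → Bool, OddZeros x ∧ LightDial.wt x ≤ 3 ∧ ¬ Rel x (z x) := by
  obtain ⟨⟨o1, w1⟩, ⟨o2, w2⟩, ⟨o3, w3⟩, ⟨o4, w4⟩, ⟨o5, w5⟩⟩ := five_lights_light (n := n) r he hn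
  by_contra hall
  push Not at hall
  exact five_lights r he hn z hz ⟨hall _ o1 w1, hall _ o2 w2, hall _ o3 w3, hall _ o4 w4, hall _ o5 w5⟩

/-- window-local STRATEGIES in the lineage's language (`P b` reads only the radius-`r` window; no degree hypothesis). -/
def IsWindowLocalStrat (r : ℕ) (P : Fin n → CubeFn (ZMod 3) n) : Prop :=
  ∀ x x' : Fin n → Bool, ∀ b : Fin n, window r x b = window r x' b → P b x = P b x'

/-- the answer map of a window-local strategy is window-local. -/
theorem isWindowLocal_ans {r : ℕ} {P : Fin n → CubeFn (ZMod 3) n} (hP : IsWindowLocalStrat r P) : IsWindowLocal r (ans P) :=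
  fun x x' b h => by simp only [ans, hP x x' b h]

/-- ★★★ LOCAL LIGHT FAIL at weight 3 (the LOCAL sub-leaf of the generic leaf, discharged with NO degree bound): for even `n ≥ 12r+8`
every radius-`r` window-local strategy loses an odd-class input of weight `≤ 3`. -/
theorem localLightFail_three (r : ℕ) (he : n % 2 = 0) (hn : 12 * r + 8 ≤ n) (P : Fin n → CubeFn (ZMod 3) n)
    (hP : IsWindowLocalStrat r P) : ∃ x : Fin n → Bool, OddZeros x ∧ LightDial.wt x ≤ 3 ∧ ¬ Rel x (ans P x) :=
  localLightLaw_three r he hn (ans P) (isWindowLocal_ans hP)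

/-- the five lightFamily as a `Fin 5`-indexed family. -/
def lightFamily (n r : ℕ) : Fin 5 → (Fin n → Bool) := ![light₁ n r, light₂ n r, light₃ n r, lightPt n (4 * r + 3), lightPt n (6 * r + 4)]

/-- ★ THE FIVE LIGHTS SEPARATE «LOCAL» FROM «AFFINE»: every `r`-local answer map loses one of them (`five_lights`), yet some AFFINE
strategy wins all five (Thm B′ `no_bounded_universal_family`: they are a bounded family) — whose answer map is therefore not `r`-local. -/
theorem five_lights_affine_winner (r : ℕ) (he : n % 2 = 0) (hn : 12 * r + 8 ≤ n) (hn' : 176 ≤ n) :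
    ∃ P : Fin n → CubeFn (ZMod 3) n, (∀ i, P i ∈ lowDeg (ZMod 3) n 1) ∧ (∀ k : Fin 5, Rel (lightFamily n r k) (ans P (lightFamily n r k))) ∧
      ¬ IsWindowLocal r (ans P) := by
  obtain ⟨⟨o1, w1⟩, ⟨o2, w2⟩, ⟨o3, w3⟩, ⟨o4, w4⟩, ⟨o5, w5⟩⟩ := five_lights_light (n := n) r he hn
  have hall : ∀ k : Fin 5, OddZeros (lightFamily n r k) ∧ LightDial.wt (lightFamily n r k) ≤ 3 := by
    intro k; fin_cases k
    exacts [⟨o1, w1⟩, ⟨o2, w2⟩, ⟨o3, w3⟩, ⟨o4, w4⟩, ⟨o5, w5⟩]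
  obtain ⟨P, hP, hwin⟩ := no_bounded_universal_family 5 3 (by omega) (by omega) le_rfl (univ.image (lightFamily n r))
    (Finset.card_image_le.trans (by simp)) (by
      intro x hx
      obtain ⟨k, _, rfl⟩ := Finset.mem_image.1 hx
      exact hall k)
  have hw : ∀ k : Fin 5, Rel (lightFamily n r k) (ans P (lightFamily n r k)) := fun k => hwin _ (Finset.mem_image_of_mem _ (Finset.mem_univ k))
  exact ⟨P, hP, hw, fun hloc => five_lights r he hn (ans P) hloc ⟨hw 0, hw 1, hw 2, hw 3, hw 4⟩⟩

end Summit.QuantumAdvantage.QuantumAdvantage.Theorems.CertDial
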